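import Mathlib
import Summits.ValiantsHypothesis.ValiantsHypothesis.Theses.BarrierLever
import Summits.ValiantsHypothesis.ValiantsHypothesis.Theorems.BarrierLeverTransversalMinorLayoutsNonsingularRefutation
import Summits.ValiantsHypothesis.ValiantsHypothesis.Theorems.BarrierLeverHubCertificatesDecideTransversal

/-!
# Route BarrierLever — item `HubCertificatesExist` (stmt-ValiantsHypothesis-19930): REFUTATION

Refutation file (`--workitem stmt-ValiantsHypothesis-19930`; cell valiant-natproofs, rung V4, 𝒟-side;
prover seat valiant-natproofs-prover gen 10). Definition-free; a corollary of the refutation of TNS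
(`TNSRefutation.not_PrincipalMinorLayoutsNonsingular`, item 19126, prover seat val-np-p3 gen 4: at `h = 31`
the layout `u = (∅, {0}, …, {30})`, `w =` all subsets of `{0,…,4}` has a singular principal-minor layout
matrix for EVERY `K`, by the capacity bound `1 + |T|² = 26 < 32`) through arrows already in the tree:

* item 19931 `HubCertificatesDecideTransversal` (the hub calculus is SOUND:
  `HubCertificatesExist → TransversalMinorLayoutsNonsingular`), proved as
  `HubGlue.hubCertificatesDecideTransversal`;
* the refutation of TT, `TNSRefutation.not_TransversalMinorLayoutsNonsingular` (item 19152, via item 19153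
  TT ⇒ TNS).

**`not_HubCertificatesExist`**: the hub-certificate conjecture (every predicate on configurations closed under
the six rules of the compression calculus holds at every injective transversal configuration) is false, since it
implies TT and TT is false. Concretely the least closed predicate («the transversal matrix coefficients of the
configuration are linearly independent») fails at the TNS-refuting layout read as a transversal configuration.

WHAT THIS IS NOT: the h ≤ 5 certificate tables (`HubCertH4*`, `HubCertH5*`) and every bounded slice
(r ≤ 8 ∀ h, h ≤ 3 ∀ r) stay true theorems; item 19717 `PartitionMinorsHitByVP` (layout-dependent witnesses)
is untouched; nothing on crux stmt-14610 or `VP` vs `VNP`.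
-/

set_option linter.dupNamespace false

namespace Summit.ValiantsHypothesis.ValiantsHypothesis.Theorems.BarrierLever.TNSRefutation

/-- **The hub-certificate conjecture is false** (item `HubCertificatesExist`, stmt-ValiantsHypothesis-19930):
by the proved arrow `HubCertificatesExist → TransversalMinorLayoutsNonsingular` (item 19931,
`HubGlue.hubCertificatesDecideTransversal`) and the refutation of TT
(`not_TransversalMinorLayoutsNonsingular`, itself from the TNS capacity counterexample at `h = 31`,
rows `∅` + singletons against the 32 subsets of a 5-block). Class: refuted-substantive (no restatement
repair: every universal certificate shape of bounded per-coordinate capacity dies on this layout family). -/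
theorem not_HubCertificatesExist :
    ¬ Summit.ValiantsHypothesis.ValiantsHypothesis.Theses.BarrierLever.HubCertificatesExist :=
  fun hHub => not_TransversalMinorLayoutsNonsingular
    (HubGlue.hubCertificatesDecideTransversal hHub)

end Summit.ValiantsHypothesis.ValiantsHypothesis.Theorems.BarrierLever.TNSRefutation
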